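import Mathlib
import HarnessLib
import Summits.NavierStokesRegularity.NavierStokesRegularity.Theorems.UnthreadedDoorNetFluxOneSidedLawCalculus

/-!
# Route `UnthreadedDoor`, crux `PoloidalLiouville` (stmt-NavierStokesRegularity-1222), WALL W1 — crux idea «null-time» (ns-idea-14 g5,
# `Cruxes/PoloidalLiouville/NullTimeSketch.lean`): stub AE-3 `CumulativeFluxLipschitz`, PROVED (by name)

`NetFlux.cumulativeFluxLipschitz : <body of NullTime.CumulativeFluxLipschitz VERBATIM>`: for `v` smooth on the window `]t₀,0[ × ℝ³`, `T` smooth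
off the centre with `curl v(t) = ∇T(t) × (x − x₀)`, and `t₀ < t₁ < t₂ < 0`, `R > 0`, the CUMULATIVE NET FLUX `t ↦ ∫₀^ρ netFlux(T t, r) dr` is
Lipschitz on `[t₁,t₂]` with ONE constant for all `ρ ∈ [0,R]`.

PROOF.  (1) `‖curl v(t)(y) − curl v(t')(y)‖ ≤ M |t − t'|` on `[t₁,t₂] × B̄(x₀,R)` (mean value in `t`; `∂ₜ curl v` is continuous on the
window, bounded on the compact — same technique as `exists_bound_curl_sub_curl`, p668552, without the centre factor).  (2) ONE sphere, TWO
fields (`abs_sphOsc_sub_sphOsc_le_of_norm_curl_sub_le`, p668205): `|osc_{S_r} T(t) − osc_{S_r} T(t')| ≤ π M |t − t'|`, so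
`|netFlux(T t, r) − netFlux(T t', r)| ≤ π M R |t − t'|` for `0 < r ≤ R` — the oscillation only sees the vorticity, so the possible
singularity of `T` at the centre is harmless.  (3) `0 ≤ netFlux(T t, r) ≤ π K R` on `]0,R]` (`oscLeVorticity`, NF-0, `K` = a bound of
`‖curl v‖` on the compact), so `netFlux(T t, ·)` is integrable on `]0,ρ[`, and
`|∫₀^ρ netFlux(T t) − ∫₀^ρ netFlux(T t')| ≤ ρ · π M R |t − t'| ≤ π M R² |t − t'|`.
In the sketch: `theorem stub_cumulativeFluxLipschitz : CumulativeFluxLipschitz := Theorems.PoloidalLiouville.NetFlux.cumulativeFluxLipschitz`.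

HONEST LABEL: one S stub of the a.e.-time chain (crux idea «null-time», K3ᵃᵉ); `PoloidalLiouville` (1222), C⁻, W1 and the summit stay OPEN; NO
Navier–Stokes regularity statement is proved.  `--supports stmt-NavierStokesRegularity-1222 --as helper`.  [folklore]
-/

noncomputable section

-- the summit and its single sub-problem share the name (CONVENTIONS §1)
set_option linter.dupNamespace false

open Set Function Filter Topology InnerProductSpace MeasureTheory
open scoped RealInnerProductSpace NNReal

namespace Summit.NavierStokesRegularity.NavierStokesRegularity.Theorems.PoloidalLiouville.NetFlux

open Literature.Analysis Literature.Analysis.FluidPDE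

variable {v : ℝ → E3 → E3} {T : ℝ → E3 → ℝ} {x₀ : E3} {t₀ t₁ t₂ : ℝ}

/-! ### Time-Lipschitz bound of the vorticity on a ball of any radius -/

/-- **`‖curl v(t)(y) − curl v(t')(y)‖ ≤ M |t − t'|` for `t, t' ∈ [t₁,t₂] ⊂ ]t₀,0[`, `y ∈ B̄(x₀,R)`** (`v` smooth on the window: `∂ₜ curl v`
is continuous, hence bounded on the compact; mean value in `t`). [folklore] -/
theorem exists_bound_curl_sub_curl_closedBall (hv : ContDiffOn ℝ (⊤ : ℕ∞) (uncurry v) (Ioo t₀ 0 ×ˢ (univ : Set E3)))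
    (h₁ : t₀ < t₁) (h₂ : t₂ < 0) (R : ℝ) :
    ∃ M : ℝ, 0 ≤ M ∧ ∀ t ∈ Icc t₁ t₂, ∀ t' ∈ Icc t₁ t₂, ∀ y ∈ Metric.closedBall x₀ R,
      ‖curl (v t) y - curl (v t') y‖ ≤ M * |t - t'| := by
  set W : Set (ℝ × E3) := Ioo t₀ 0 ×ˢ (univ : Set E3) with hWdef
  have hW : IsOpen W := isOpen_Ioo.prod isOpen_univ
  set Om : ℝ × E3 → E3 := fun q => curl (v q.1) q.2 with hOmdef
  have hOm : ContDiffOn ℝ (⊤ : ℕ∞) Om W := contDiffOn_curl_family hv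
  set Om₁ : ℝ × E3 → E3 := fun q => deriv (fun s => Om (s, q.2)) q.1 with hOm₁def
  have hOm₁ : ContDiffOn ℝ (⊤ : ℕ∞) Om₁ W := (contDiffOn_deriv_tslice hW hOm).2
  have hK : IsCompact (Icc t₁ t₂ ×ˢ Metric.closedBall x₀ R) := isCompact_Icc.prod (isCompact_closedBall _ _)
  have hIcc : Icc t₁ t₂ ⊆ Ioo t₀ 0 := fun s hs => ⟨h₁.trans_le hs.1, lt_of_le_of_lt hs.2 h₂⟩
  have hKW : Icc t₁ t₂ ×ˢ Metric.closedBall x₀ R ⊆ W := fun q hq => ⟨hIcc hq.1, mem_univ _⟩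
  obtain ⟨M₀, hM₀⟩ := hK.exists_bound_of_continuousOn (hOm₁.continuousOn.mono hKW)
  set M : ℝ := max M₀ 0 with hM
  have hslt : ∀ y : E3, ∀ s ∈ Ioo t₀ 0, HasDerivAt (fun σ => Om (σ, y)) (Om₁ (s, y)) s := by
    intro y s hs
    have hq : ((s, y) : ℝ × E3) ∈ W := ⟨hs, mem_univ _⟩
    have hd : DifferentiableAt ℝ Om (s, y) := (hOm.differentiableOn (by simp) _ hq).differentiableAt (hW.mem_nhds hq)
    have e : (fun σ : ℝ => Om (σ, y)) = Om ∘ fun σ => (σ, y) := rfl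
    have h1 : DifferentiableAt ℝ (fun σ : ℝ => Om (σ, y)) s := by
      rw [e]
      exact hd.comp s (differentiableAt_id.prodMk (differentiableAt_const y))
    exact h1.hasDerivAt
  refine ⟨M, le_max_right _ _, fun t ht t' ht' y hy => ?_⟩
  have h := (convex_Icc t₁ t₂).norm_image_sub_le_of_norm_hasDerivWithin_le
    (f := fun σ => Om (σ, y)) (f' := fun σ => Om₁ (σ, y))
    (fun σ hσ => (hslt y σ (hIcc hσ)).hasDerivWithinAt)
    (fun σ hσ => (hM₀ (σ, y) ⟨hσ, hy⟩).trans (le_max_left M₀ 0)) ht' ht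
  rw [Real.norm_eq_abs] at h
  exact h

/-- **A bound of the vorticity on `[t₁,t₂] × B̄(x₀,R)`.** [folklore] -/
theorem exists_bound_curl_closedBall (hv : ContDiffOn ℝ (⊤ : ℕ∞) (uncurry v) (Ioo t₀ 0 ×ˢ (univ : Set E3)))
    (h₁ : t₀ < t₁) (h₂ : t₂ < 0) (R : ℝ) :
    ∃ K : ℝ, 0 ≤ K ∧ ∀ t ∈ Icc t₁ t₂, ∀ y ∈ Metric.closedBall x₀ R, ‖curl (v t) y‖ ≤ K := by
  have hK : IsCompact (Icc t₁ t₂ ×ˢ Metric.closedBall x₀ R) := isCompact_Icc.prod (isCompact_closedBall _ _)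
  have hKW : Icc t₁ t₂ ×ˢ Metric.closedBall x₀ R ⊆ Ioo t₀ 0 ×ˢ (univ : Set E3) := fun q hq =>
    ⟨⟨h₁.trans_le hq.1.1, lt_of_le_of_lt hq.1.2 h₂⟩, mem_univ _⟩
  obtain ⟨K, hK'⟩ := hK.exists_bound_of_continuousOn ((contDiffOn_curl_family hv).continuousOn.mono hKW)
  exact ⟨max K 0, le_max_right _ _, fun t ht y hy => (hK' (t, y) ⟨ht, hy⟩).trans (le_max_left _ _)⟩

/-! ### AE-3 -/

/-- **AE-3 `CumulativeFluxLipschitz`, proved**: the cumulative net flux `t ↦ ∫₀^ρ netFlux(T t, r) dr` of a toroidal representation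
`curl v = ∇T × (x − x₀)` (smooth window data) is Lipschitz in time on `[t₁,t₂]`, uniformly in `ρ ∈ [0,R]`.  Statement = the sketch's
`NullTime.CumulativeFluxLipschitz` verbatim.  No NS statement is involved. [folklore] -/
theorem cumulativeFluxLipschitz :
    ∀ (v : ℝ → E3 → E3) (x₀ : E3) (T : ℝ → E3 → ℝ) (t₀ : ℝ),
    ContDiffOn ℝ (⊤ : ℕ∞) (uncurry v) (Ioo t₀ 0 ×ˢ univ) →
    ContDiffOn ℝ (⊤ : ℕ∞) (uncurry T) (Ioo t₀ 0 ×ˢ ({x₀}ᶜ : Set E3)) →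
    (∀ t ∈ Ioo t₀ 0, ∀ x, curl (v t) x = cross (gradient (T t) x) (x - x₀)) →
    ∀ t₁ t₂ R : ℝ, t₀ < t₁ → t₁ < t₂ → t₂ < 0 → 0 < R →
      ∃ L : NNReal, ∀ ρ ∈ Icc 0 R,
        LipschitzOnWith L (fun t => ∫ r in Ioo 0 ρ, netFlux (T t) x₀ r) (Icc t₁ t₂) := by
  intro v x₀ T t₀ hv hT hrep t₁ t₂ R h01 h12 h20 hR
  have hIcc : Icc t₁ t₂ ⊆ Ioo t₀ 0 := fun s hs => ⟨h01.trans_le hs.1, lt_of_le_of_lt hs.2 h20⟩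
  have h1top : (1 : WithTop ℕ∞) ≤ ((⊤ : ℕ∞) : WithTop ℕ∞) := WithTop.coe_le_coe.2 le_top
  have hvt : ∀ t ∈ Ioo t₀ 0, ContDiff ℝ 1 (v t) := fun t ht => (contDiff_slice_of_window hv ht).of_le h1top
  have hTt : ∀ t ∈ Ioo t₀ 0, ContDiffOn ℝ 1 (T t) ({x₀}ᶜ) := fun t ht => (contDiffOn_slice_compl hT ht).of_le h1top
  obtain ⟨M, hM0, hM⟩ := exists_bound_curl_sub_curl_closedBall (x₀ := x₀) hv h01 h20 R
  obtain ⟨K, hK0, hK⟩ := exists_bound_curl_closedBall (x₀ := x₀) hv h01 h20 R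
  have hπ : 0 ≤ Real.pi := Real.pi_pos.le
  have hsph : ∀ {r : ℝ}, r ≤ R → Metric.sphere x₀ r ⊆ Metric.closedBall x₀ R := fun hr =>
    Metric.sphere_subset_closedBall.trans (Metric.closedBall_subset_closedBall hr)
  -- (2) one radius, two times
  have hdiff : ∀ t ∈ Icc t₁ t₂, ∀ t' ∈ Icc t₁ t₂, ∀ r : ℝ, 0 < r → r ≤ R →
      |netFlux (T t) x₀ r - netFlux (T t') x₀ r| ≤ Real.pi * M * R * |t - t'| := by
    intro t ht t' ht' r hr hrR
    have h := abs_sphOsc_sub_sphOsc_le_of_norm_curl_sub_le (x₀ := x₀) (K := M * |t - t'|) hr (hTt t (hIcc ht))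
      (hTt t' (hIcc ht')) (hrep t (hIcc ht)) (hrep t' (hIcc ht')) (fun x hx => hM t ht t' ht' x (hsph hrR hx))
    have e : netFlux (T t) x₀ r - netFlux (T t') x₀ r = r * (sphOsc (T t) x₀ r - sphOsc (T t') x₀ r) := by
      unfold netFlux; ring
    rw [e, abs_mul, abs_of_pos hr]
    have h2 : r * |sphOsc (T t) x₀ r - sphOsc (T t') x₀ r| ≤ R * (Real.pi * (M * |t - t'|)) :=
      mul_le_mul hrR h (abs_nonneg _) hR.le
    calc r * |sphOsc (T t) x₀ r - sphOsc (T t') x₀ r| ≤ R * (Real.pi * (M * |t - t'|)) := h2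
      _ = Real.pi * M * R * |t - t'| := by ring
  -- (3) size bound and integrability on `]0,ρ[`, `ρ ≤ R`
  have hsize : ∀ t ∈ Icc t₁ t₂, ∀ r : ℝ, 0 < r → r ≤ R → |netFlux (T t) x₀ r| ≤ Real.pi * K * R := by
    intro t ht r hr hrR
    have hc := continuousOn_sphere_of_continuousOn_compl (hTt t (hIcc ht)).continuousOn hr
    have hosc : sphOsc (T t) x₀ r ≤ Real.pi * K :=
      oscLeVorticity (v t) x₀ (T t) r K hr (hvt t (hIcc ht)) (hTt t (hIcc ht)) (hrep t (hIcc ht))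
        (fun x hx => hK t ht x (hsph hrR hx))
    have hosc0 : 0 ≤ sphOsc (T t) x₀ r := sphOsc_nonneg_of_continuousOn hc hr.le
    unfold netFlux
    rw [abs_of_nonneg (mul_nonneg hr.le hosc0)]
    calc r * sphOsc (T t) x₀ r ≤ R * (Real.pi * K) := mul_le_mul hrR hosc hosc0 hR.le
      _ = Real.pi * K * R := by ring
  have hint : ∀ t ∈ Icc t₁ t₂, ∀ ρ : ℝ, ρ ≤ R → IntegrableOn (fun r => netFlux (T t) x₀ r) (Ioo 0 ρ) := by
    intro t ht ρ hρR
    have hc : ContinuousOn (fun r => netFlux (T t) x₀ r) (Ioo 0 ρ) :=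
      (continuousOn_netFlux_slice hT.continuousOn (hIcc ht)).mono Ioo_subset_Ioi_self
    refine ⟨hc.aestronglyMeasurable measurableSet_Ioo, ?_⟩
    refine HasFiniteIntegral.restrict_of_bounded (C := Real.pi * K * R) measure_Ioo_lt_top ?_
    refine (ae_restrict_mem measurableSet_Ioo).mono fun r hr => ?_
    rw [Real.norm_eq_abs]
    exact hsize t ht r hr.1 (hr.2.le.trans hρR)
  -- (4) the Lipschitz estimate
  refine ⟨Real.toNNReal (Real.pi * M * R * R), fun ρ hρ => ?_⟩
  refine LipschitzOnWith.of_dist_le' fun t ht t' ht' => ?_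
  rw [Real.dist_eq, Real.dist_eq]
  have hρ0 : 0 ≤ ρ := hρ.1
  have hsub : (∫ r in Ioo 0 ρ, netFlux (T t) x₀ r) - (∫ r in Ioo 0 ρ, netFlux (T t') x₀ r) =
      ∫ r in Ioo 0 ρ, (netFlux (T t) x₀ r - netFlux (T t') x₀ r) :=
    (integral_sub (hint t ht ρ hρ.2) (hint t' ht' ρ hρ.2)).symm
  rw [hsub]
  have hb := norm_setIntegral_le_of_norm_le_const (μ := volume) (s := Ioo 0 ρ)
    (f := fun r => netFlux (T t) x₀ r - netFlux (T t') x₀ r) (C := Real.pi * M * R * |t - t'|) measure_Ioo_lt_top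
    (fun r hr => by rw [Real.norm_eq_abs]; exact hdiff t ht t' ht' r hr.1 (hr.2.le.trans hρ.2))
  rw [Real.norm_eq_abs, Measure.real, Real.volume_Ioo, sub_zero, ENNReal.toReal_ofReal hρ0] at hb
  have hMt : 0 ≤ Real.pi * M * R * |t - t'| := by positivity
  calc |∫ r in Ioo 0 ρ, (netFlux (T t) x₀ r - netFlux (T t') x₀ r)| ≤ Real.pi * M * R * |t - t'| * ρ := hb
    _ ≤ Real.pi * M * R * |t - t'| * R := mul_le_mul_of_nonneg_left hρ.2 hMt
    _ = Real.pi * M * R * R * |t - t'| := by ring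

end Summit.NavierStokesRegularity.NavierStokesRegularity.Theorems.PoloidalLiouville.NetFlux

end
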